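import Summits.BirchSwinnertonDyer.BirchSwinnertonDyer.Theorems.ThetaPartnerAtTwoSignedKatoUpToAtTwoLayerPairingModDefs
import Literature.NumberTheory.EllipticCurves.ZpExtensionGaloisTwistLocalKummer
import Literature.NumberTheory.GaloisRepresentations.ContinuousCohomologyVanishing
import HarnessLib

/-!
# Route `ResidualThetaTransportAtTwo` (RTT P6, item stmt-BirchSwinnertonDyer-23110, road T), ISO brick (1) TWIST-DICT:
# on the layer group `U_m ≤ Γ_{ℚ_v}` (`m ≥ J`) the Greenberg twist `E[p^J](χ_u)` IS `E[p^J]` — an isomorphism of `U_m`-representations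
# with underlying map the identity

Seat `prover-bsd-wall-tp2-p2x` g12 LEAD (`--supports stmt-BirchSwinnertonDyer-23110`). THEOREMS ONLY (the isomorphism is asserted to EXIST with
underlying identity — no definition, no named fact, no `sorry`); closes nothing; BSD is NOT proved by any of this.

Greenberg (LNM 1716, §4 p. 107): «As `G_{F_∞}`-modules, `A_s = E[p^∞]`»; at finite level: the character `χ_u = u^{κ(·)/κ(γ)}` is `≡ 1 (mod p^J)`
on `Gal(K̄/K_J) = κ⁻¹(p^J ℤ_p)` (tree: `ZpExtension.galoisTwist_apply_of_mem_layerSubgroup`), so on the local layer group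
`U_m = layerGroup κ v m = res⁻¹(κ⁻¹(p^m ℤ_p)) ≤ Γ_{ℚ_v}`, `m ≥ J`, the restricted twisted module `E[p^J](χ_u)|` and the K3 layer currency's
`torsionLocalRep W (p^J) v = E[p^J]|` are the SAME `U_m`-representation. This is step (1) of the lead's ISO programme (memo v5): it lets the
twisted local Kummer conditions `L_u ⊆ H¹(Γ_{ℚ_v}, E[p^J](χ_u))` be restricted to / corestricted from the untwisted layer cohomology
`H¹(U_m, E[p^J]|)` of the Shapiro model.

* **`exists_subgroupRep_twisted_iso_of_le`** — for `J ≤ m`: `∃ Φ : (E[p^J](χ_u)|_{Γ_v})|_{U_m} ≅ (E[p^J]|_{Γ_v})|_{U_m}` with `Φ.hom.hom x = x`.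

References: [GreenbergLNM1716] §4 p. 107; [Washington1997] §13.1; [Kobayashi2003] Def. 1.1.
-/

-- the Theorems namespace of this sub repeats the summit name by design (D-0017 nested layout)
set_option linter.dupNamespace false

noncomputable section

open scoped Classical Topology

namespace Summit.BirchSwinnertonDyer.BirchSwinnertonDyer.Theorems.SignedEC.TwistLayer

open CategoryTheory Field NumberField IsDedekindDomain WeierstrassCurve Literature.NumberTheory.EllipticCurves
  Literature.NumberTheory.GaloisRepresentations ZpExtension
open Summit.BirchSwinnertonDyer.BirchSwinnertonDyer.Theorems.SignedKatoOffTwo.LayerPairing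

/-- **TWIST-DICT.** For `J ≤ m`, the restriction to the local layer group `U_m = layerGroup κ v m` of the twisted module
`E[p^J](χ_u)|_{Γ_{ℚ_v}}` is isomorphic to that of `E[p^J]|_{Γ_{ℚ_v}}` (`torsionLocalRep W (p^J) v`) by an isomorphism of topological
`U_m`-representations whose underlying map is the identity (`χ_u ≡ 1 (mod p^J)` on `κ⁻¹(p^m ℤ_p) ⊆ κ⁻¹(p^J ℤ_p)`).
[cite: GreenbergLNM1716, §4 p. 107] [cite: Washington1997, §13.1] -/
theorem exists_subgroupRep_twisted_iso_of_le (W : WeierstrassCurve ℚ) [W.IsElliptic] (p : ℕ) [Fact p.Prime]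
    (κ : ZpExtension ℚ p) (v : HeightOneSpectrum (𝓞 ℚ)) {J m : ℕ} (hJm : J ≤ m) (u : ℤ) (hu : (p : ℤ) ∣ u - 1) :
    ∃ Φ : subgroupRep (DiscreteGaloisModule.toTopRep
          (GaloisRep.restrictField (v.adicCompletion ℚ) (W.twistedTorsionGaloisModule p κ J u hu))) (layerGroup κ v m) ≅
        subgroupRep (torsionLocalRep W (p ^ J) v) (layerGroup κ v m),
      ∀ x, Φ.hom.hom x = x := by
  haveI : NeZero (p ^ J) := ⟨pow_ne_zero _ (Fact.out : p.Prime).ne_zero⟩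
  -- the identity as a continuous linear equivalence between the two carriers (the same type `E[p^J](ℚ̄)`)
  let eqv : (subgroupRep (DiscreteGaloisModule.toTopRep
          (GaloisRep.restrictField (v.adicCompletion ℚ) (W.twistedTorsionGaloisModule p κ J u hu))) (layerGroup κ v m)) ≃L[ℤ]
        (subgroupRep (torsionLocalRep W (p ^ J) v) (layerGroup κ v m)) :=
    ContinuousLinearEquiv.refl ℤ _
  refine ⟨topRepIsoOfEquiv eqv fun h x ↦ ?_, fun x ↦ rfl⟩
  -- equivariance: on `U_m` the twist exponent vanishes modulo `p^J`
  have hmem : absGaloisRestrict ℚ (v.adicCompletion ℚ) (h : absoluteGaloisGroup (v.adicCompletion ℚ)) ∈ κ.layerSubgroup J := by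
    have h1 : (h : absoluteGaloisGroup (v.adicCompletion ℚ)) ∈ layerGroup κ v m := h.2
    rw [mem_localSubgroupOfEmb_iff, ← resGal_eq, resGal_eq_absGaloisRestrict] at h1
    exact κ.layerSubgroup_antitone hJm h1
  change (W.twistedTorsionGaloisModule p κ J u hu) (absGaloisRestrict ℚ (v.adicCompletion ℚ) (h : absoluteGaloisGroup (v.adicCompletion ℚ))) x =
    (W.torsionGaloisModule ((p ^ J : ℕ) : ℤ)) (absGaloisRestrict ℚ (v.adicCompletion ℚ) (h : absoluteGaloisGroup (v.adicCompletion ℚ))) x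
  exact κ.galoisTwist_apply_of_mem_layerSubgroup (W.torsionGaloisModule ((p ^ J : ℕ) : ℤ)) J (W.pow_nsmul_geomTorsion_pow p J) u hu hmem x

end Summit.BirchSwinnertonDyer.BirchSwinnertonDyer.Theorems.SignedEC.TwistLayer

end
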